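import Mathlib
import Literature.Analysis.FluidPDE.Tao2016AveragedNS.RenormalisedCascadeWaves
import Literature.Analysis.FluidPDE.Tao2016AveragedNS.SelfSimilarCascadeBlowup
import Literature.Analysis.FluidPDE.Tao2016AveragedNS.ViscousEternalSolutions
import Literature.Analysis.FluidPDE.Tao2016AveragedNS.BoundedEternalSolutions
import Summits.NavierStokesRegularity.NavierStokesRegularity.Theses.TaoLadderRungTwoBreak
import Summits.NavierStokesRegularity.NavierStokesRegularity.Theorems.TaoLadderRungTwoBreakNoSurvivingEternalViscBddOneWakeCriterion
import Summits.NavierStokesRegularity.NavierStokesRegularity.Theorems.TaoLadderRungTwoBreakNoSurvivingEternalViscBddOneWakeDyadicClassical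
import Summits.NavierStokesRegularity.NavierStokesRegularity.Theorems.WakeRatchetAdmissibleEternalBoundCritical
import Summits.NavierStokesRegularity.NavierStokesRegularity.Theorems.WakeRatchetAdmissibleEternalBoundDyadic
import Summits.NavierStokesRegularity.NavierStokesRegularity.Theorems.WakeRatchetTailRatchet.Negative.TailRatchetFalseOfDyadicScalarFronts

/-!
# Crux `TaoLadderRungTwoBreak.NoSurvivingEternalViscBddOne` (stmt-NavierStokesRegularity-20419):
# the classical form of the dyadic slice is EXACT — converse embedding and the equivalence

Companion of `…WakeDyadicClassical` (this hand), which proved: CLASSICAL FORM ⇒ no forward (S₁)-survival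
on the dyadic member.  Here the CONVERSE: every real solution `V` of the ungraded Katz–Pavlović chain in
critical variables

  `V̇_n = Λ V_{n-1}² − Λ⁻¹ V_n V_{n+1}`  on `t < 0`      (KP-crit),

with uniformly integrable shells (`∫_{t<0}|V_n| ≤ M`) and shells bounded near `0⁻`, EMBEDS as an
admissible inviscid eternal solution of `dyadicTable`, `W_n(σ) := (e^{-σ} V_n(-e^{-σ})) · e₀`
(`isEternal_dyadic_of_classical`: the law by the chain rule and the dyadic table's bilinear forms
tree `WakeRatchetDyadicFront.qform_dyadicTable`; the action by the change of variables `t = -e^{-σ}`, tree `integrable_recentre_iff`;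
the forward clause from the bound near `0⁻`).  Its terminal profile is `V_n(0⁻) · e₀`, so the wake
criterion gives `classical_of_dyadic_not_survivingFwd`, whence

* `dyadic_noSurviving_iff_classical` — at each `ε₀ > 0`: «no admissible inviscid eternal solution of the
  dyadic member is forward (S₁)-surviving» ⟺ «every such `V` has `(1+ε₀)^{-4n} V_n(0⁻)² → 0`»
  (`physWeight(1)^n v_n²`; K41 is `v_n ≍ Λ^{2n/3}`, the threshold `Λ^{4n/5}`);
* `classical_of_noSurvivingEternalBddOne` — (ρ0) BY NAME forces the classical form below its threshold;
* §2 (appended): the same equivalence with the classical side restricted to NON-NEGATIVE, TYPE-I solutions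
  (`dyadic_noSurviving_iff_classicalPos`, `classicalPos_of_noSurvivingEternalBddOne`) — no loss, since both
  properties are automatic for admissible dyadic solutions.

So the dyadic slice of (ρ0) / of K1ᵛ(1)'s inviscid half / of ⟨20205⟩'s `stub_eternalLiouville` is ONE
explicit statement about ONE scalar lattice ODE with no reference to the cell's vocabulary — the form in
which it can be handed to the dyadic-model literature (open there at base `Λ → 1`).

MODEL lattice ODEs only (Tao 2016 §1.2, §4, §6.4); nothing here is a statement about the Navier–Stokes
equations; crux ⟨20419⟩, its children and every NS statement remain OPEN.
-/

noncomputable section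

-- the summit and its single sub-problem share the name (CONVENTIONS §1)
set_option linter.dupNamespace false

namespace Summit.NavierStokesRegularity.NavierStokesRegularity.Theorems.NoSurvivingEternalViscBddOne.WakeCriterion

open Filter Topology Set MeasureTheory
open Literature.Analysis.FluidPDE Literature.Analysis.FluidPDE.TaoCascade
open Summit.NavierStokesRegularity.NavierStokesRegularity.Theses.TaoLadderRungTwoBreak
open Summit.NavierStokesRegularity.NavierStokesRegularity.Theorems.WakeRatchetCritical
  (integrable_recentre_iff hasDerivAt_sub_exp_neg)
open Summit.NavierStokesRegularity.NavierStokesRegularity.Theorems.WakeRatchetDyadic (uniformBound_dyadic)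
open Summit.NavierStokesRegularity.NavierStokesRegularity.Theorems.WakeRatchetDyadicFront (qform_dyadicTable)

variable {ε₀ : ℝ}

/-- `-e^{-σ} → 0⁻` as `σ → +∞`. [folklore] -/
theorem tendsto_neg_exp_neg_nhdsLT_zero :
    Tendsto (fun σ : ℝ => -Real.exp (-σ)) atTop (𝓝[<] (0 : ℝ)) := by
  refine tendsto_nhdsWithin_iff.2 ⟨?_, Eventually.of_forall fun σ => ?_⟩
  · simpa using Real.tendsto_exp_neg_atTop_nhds_zero.neg
  · exact neg_neg_iff_pos.2 (Real.exp_pos _)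

/-- **EMBEDDING: a classical solution of (KP-crit) is an admissible eternal solution of the dyadic member.**
Given real shells `V_n` solving `V̇_n = ΛV_{n-1}² − Λ⁻¹V_nV_{n+1}` on `t < 0` with uniformly integrable
shells and shells bounded near `0⁻`, `W_n(σ) := (e^{-σ} V_n(-e^{-σ})) · e₀` is an admissible inviscid eternal
solution of `dyadicTable` (blow-up time re-centred at `0`).
[cite: Tao2016AveragedNS, §1.2, §4 Lemma 4.1 (4.8), §6.4; cell vocabulary (`IsEternal`); tree `integrable_recentre_iff`] -/
theorem isEternal_dyadic_of_classical {V : ℤ → ℝ → ℝ}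
    (hV : ∀ (n : ℤ) (t : ℝ), t < 0 →
      HasDerivAt (V n) (bigLam ε₀ * V (n - 1) t ^ 2 - (bigLam ε₀)⁻¹ * (V n t * V (n + 1) t)) t)
    (hact : ∃ M : ℝ, ∀ n : ℤ, IntegrableOn (fun t => |V n t|) (Iio 0) ∧ ∫ t in Iio 0, |V n t| ≤ M)
    (hbd : ∀ n : ℤ, ∃ t₀ : ℝ, t₀ < 0 ∧ ∃ P : ℝ, ∀ t : ℝ, t₀ ≤ t → t < 0 → |V n t| ≤ P) :
    IsEternal ε₀ dyadicTable
      (fun n σ => (Real.exp (-σ) * V n (-Real.exp (-σ))) • (PiLp.single 2 (0 : Fin 4) (1 : ℝ) : Em 4)) := by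
  set e₀ : Em 4 := (PiLp.single 2 (0 : Fin 4) (1 : ℝ) : Em 4) with he₀
  have he₀j : ∀ j : Fin 4, e₀ j = if j = 0 then 1 else 0 := fun j => by
    rw [he₀, PiLp.single_apply]
  have hne₀ : ‖e₀‖ = 1 := by rw [he₀, PiLp.norm_single, norm_one]
  refine ⟨fun n σ => ?_, ?_, fun n => ?_⟩
  · -- the law
    have hlt : -Real.exp (-σ) < 0 := neg_neg_iff_pos.2 (Real.exp_pos _)
    have h1 : HasDerivAt (fun s : ℝ => Real.exp (-s)) (-Real.exp (-σ)) σ := by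
      have h0 : HasDerivAt (fun s : ℝ => Real.exp (-s)) (Real.exp (-σ) * (-1)) σ :=
        (Real.hasDerivAt_exp (-σ)).comp σ ((hasDerivAt_id σ).neg)
      convert h0 using 1
      ring
    have h2 : HasDerivAt (fun s : ℝ => -Real.exp (-s)) (Real.exp (-σ)) σ := by
      have hf : (fun s : ℝ => -Real.exp (-s)) = fun s => 0 - Real.exp (-s) := by
        funext s; ring
      rw [hf]
      exact hasDerivAt_sub_exp_neg 0 σ
    have hcomp := (hV n _ hlt).scomp σ h2
    have hprod := h1.mul hcomp
    have hvec := hprod.smul_const e₀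
    refine hvec.congr_deriv ?_
    ext j
    simp only [Function.comp_apply, smul_eq_mul, PiLp.smul_apply, PiLp.add_apply, PiLp.neg_apply,
      tableQ_apply, tableA_apply, tableB_apply, qform_dyadicTable, he₀j, one_smul]
    by_cases hj : j = 0
    · subst hj
      simp [dyadicTable]
      ring
    · simp [hj]
  · -- the action
    obtain ⟨M, hM⟩ := hact
    refine ⟨M, fun n => ?_⟩
    have h := integrable_recentre_iff (fun t : ℝ => (V n t) • e₀) 0
    have hfun : (fun σ : ℝ => ‖Real.exp (-σ) • (fun t : ℝ => V n t • e₀) (0 - Real.exp (-σ))‖)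
        = fun σ : ℝ => ‖(Real.exp (-σ) * V n (-Real.exp (-σ))) • e₀‖ := by
      funext σ
      rw [zero_sub, smul_smul]
    have hU : (fun t : ℝ => ‖(fun t : ℝ => V n t • e₀) t‖) = fun t : ℝ => |V n t| := by
      funext t
      simp only [norm_smul, Real.norm_eq_abs, hne₀, mul_one]
    rw [hfun, hU] at h
    exact ⟨h.1.2 (hM n).1, by rw [h.2 (hM n).1]; exact (hM n).2⟩
  · -- the forward bound
    obtain ⟨t₀, ht₀, P, hP⟩ := hbd n
    refine ⟨-Real.log (-t₀), P ^ 2, fun σ hσ => ?_⟩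
    have hnt₀ : 0 < -t₀ := neg_pos.2 ht₀
    have hle : t₀ ≤ -Real.exp (-σ) := by
      have h1 : Real.exp (-σ) ≤ Real.exp (Real.log (-t₀)) := Real.exp_le_exp.2 (by linarith)
      rw [Real.exp_log hnt₀] at h1
      linarith
    have hPt := hP _ hle (neg_neg_iff_pos.2 (Real.exp_pos _))
    have hP0 : 0 ≤ P := (abs_nonneg _).trans hPt
    have hw : Real.exp (2 * σ) * ‖(Real.exp (-σ) * V n (-Real.exp (-σ))) • e₀‖ ^ 2
        = |V n (-Real.exp (-σ))| ^ 2 := by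
      rw [norm_smul, hne₀, mul_one, Real.norm_eq_abs, abs_mul, abs_of_pos (Real.exp_pos _), mul_pow,
        ← mul_assoc, ← Real.exp_nat_mul, ← Real.exp_add]
      have : (2 : ℝ) * σ + ((2 : ℕ) : ℝ) * -σ = 0 := by push_cast; ring
      rw [this, Real.exp_zero, one_mul]
    rw [hw]
    exact pow_le_pow_left₀ (abs_nonneg _) hPt 2

/-- **NO SURVIVAL ON THE DYADIC MEMBER ⇒ THE CLASSICAL FORM (fixed `ε₀ ≥ 0`).**  If no admissible inviscid
eternal solution of `dyadicTable` at scale ratio `1+ε₀` is forward (S₁)-surviving, then every real solution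
of (KP-crit) with uniformly integrable shells and shells bounded near `0⁻` has terminal values with
`physWeight(1)^n v_n² → 0` — the embedding `isEternal_dyadic_of_classical` plus this hand's wake criterion.
[cite: Tao2016AveragedNS, §1.2, §4 Thm. 4.2 (statement shape), §6.4; this file and `…WakeCriterion`] -/
theorem classical_of_dyadic_not_survivingFwd (hε : 0 ≤ ε₀)
    (hA : ∀ W : ℤ → ℝ → Em 4, IsEternal ε₀ dyadicTable W → ¬ EternalSurvivingFwd 1 ε₀ W) :
    ∀ V : ℤ → ℝ → ℝ,
      (∀ (n : ℤ) (t : ℝ), t < 0 →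
        HasDerivAt (V n) (bigLam ε₀ * V (n - 1) t ^ 2 - (bigLam ε₀)⁻¹ * (V n t * V (n + 1) t)) t) →
      (∃ M : ℝ, ∀ n : ℤ, IntegrableOn (fun t => |V n t|) (Iio 0) ∧ ∫ t in Iio 0, |V n t| ≤ M) →
      (∀ n : ℤ, ∃ t₀ : ℝ, t₀ < 0 ∧ ∃ P : ℝ, ∀ t : ℝ, t₀ ≤ t → t < 0 → |V n t| ≤ P) →
      ∀ v : ℤ → ℝ, (∀ n : ℤ, Tendsto (V n) (𝓝[<] 0) (𝓝 (v n))) →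
        Tendsto (fun n : ℕ => physWeight 1 ε₀ ^ n * v n ^ 2) atTop (𝓝 0) := by
  intro V hV hact hbd v hv
  set e₀ : Em 4 := (PiLp.single 2 (0 : Fin 4) (1 : ℝ) : Em 4) with he₀
  have hne₀ : ‖e₀‖ = 1 := by rw [he₀, PiLp.norm_single, norm_one]
  have hW := isEternal_dyadic_of_classical (ε₀ := ε₀) hV hact hbd
  have hns := hA _ hW
  -- the terminal profile of the embedded solution is `(v n) • e₀`
  have hr : ∀ k : ℤ, Tendsto (fun σ : ℝ => Real.exp σ •
      ((Real.exp (-σ) * V k (-Real.exp (-σ))) • e₀)) atTop (𝓝 ((v k) • e₀)) := by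
    intro k
    have h1 : Tendsto (fun σ : ℝ => V k (-Real.exp (-σ))) atTop (𝓝 (v k)) :=
      (hv k).comp tendsto_neg_exp_neg_nhdsLT_zero
    have h2 := h1.smul_const e₀
    refine h2.congr' (Eventually.of_forall fun σ => ?_)
    show V k (-Real.exp (-σ)) • e₀ = Real.exp σ • ((Real.exp (-σ) * V k (-Real.exp (-σ))) • e₀)
    rw [smul_smul, ← mul_assoc, ← Real.exp_add, add_neg_cancel, Real.exp_zero, one_mul]
  have hlim := weightedWake_tendsto_zero_of_not_survivingFwd hε hr hns
  refine hlim.congr' (Eventually.of_forall fun n => ?_)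
  show physWeight 1 ε₀ ^ n * ‖v n • e₀‖ ^ 2 = physWeight 1 ε₀ ^ n * v n ^ 2
  rw [norm_smul, hne₀, mul_one, Real.norm_eq_abs, sq_abs]

/-- **THE EQUIVALENCE (fixed `ε₀ > 0`).**  «No admissible inviscid eternal solution of the dyadic member is
forward (S₁)-surviving» ⟺ «every real solution of (KP-crit) `V̇_n = ΛV_{n-1}² − Λ⁻¹V_nV_{n+1}` on `t < 0`
with uniformly integrable shells and shells bounded near `0⁻` has `(1+ε₀)^{-4n} V_n(0⁻)² → 0`».
[cite: Tao2016AveragedNS, §1.2, §4 Thm. 4.2 (statement shape), §6.4; this file and `…WakeDyadicClassical`] -/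
theorem dyadic_noSurviving_iff_classical (hε : 0 < ε₀) :
    (∀ W : ℤ → ℝ → Em 4, IsEternal ε₀ dyadicTable W → ¬ EternalSurvivingFwd 1 ε₀ W) ↔
    (∀ V : ℤ → ℝ → ℝ,
      (∀ (n : ℤ) (t : ℝ), t < 0 →
        HasDerivAt (V n) (bigLam ε₀ * V (n - 1) t ^ 2 - (bigLam ε₀)⁻¹ * (V n t * V (n + 1) t)) t) →
      (∃ M : ℝ, ∀ n : ℤ, IntegrableOn (fun t => |V n t|) (Iio 0) ∧ ∫ t in Iio 0, |V n t| ≤ M) →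
      (∀ n : ℤ, ∃ t₀ : ℝ, t₀ < 0 ∧ ∃ P : ℝ, ∀ t : ℝ, t₀ ≤ t → t < 0 → |V n t| ≤ P) →
      ∀ v : ℤ → ℝ, (∀ n : ℤ, Tendsto (V n) (𝓝[<] 0) (𝓝 (v n))) →
        Tendsto (fun n : ℕ => physWeight 1 ε₀ ^ n * v n ^ 2) atTop (𝓝 0)) :=
  ⟨fun hA => classical_of_dyadic_not_survivingFwd hε.le hA,
    fun hB _ hW => dyadic_not_survivingFwd_of_classical hε hB hW⟩

/-- **(ρ0) BY NAME ⇒ the classical form below its threshold** (`R = 2`, `inTableClass_dyadicTable`,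
`uniformBound_dyadic`).
[cite: Tao2016AveragedNS, §1.2, §4 Thm. 4.2 (statement shape), §6.4; this file] -/
theorem classical_of_noSurvivingEternalBddOne (h : NoSurvivingEternalBddOne) :
    ∃ εs : ℝ, 0 < εs ∧ ∀ ε₀ : ℝ, 0 < ε₀ → ε₀ ≤ εs → ∀ V : ℤ → ℝ → ℝ,
      (∀ (n : ℤ) (t : ℝ), t < 0 →
        HasDerivAt (V n) (bigLam ε₀ * V (n - 1) t ^ 2 - (bigLam ε₀)⁻¹ * (V n t * V (n + 1) t)) t) →
      (∃ M : ℝ, ∀ n : ℤ, IntegrableOn (fun t => |V n t|) (Iio 0) ∧ ∫ t in Iio 0, |V n t| ≤ M) →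
      (∀ n : ℤ, ∃ t₀ : ℝ, t₀ < 0 ∧ ∃ P : ℝ, ∀ t : ℝ, t₀ ≤ t → t < 0 → |V n t| ≤ P) →
      ∀ v : ℤ → ℝ, (∀ n : ℤ, Tendsto (V n) (𝓝[<] 0) (𝓝 (v n))) →
        Tendsto (fun n : ℕ => physWeight 1 ε₀ ^ n * v n ^ 2) atTop (𝓝 0) := by
  obtain ⟨εs, hεs, H⟩ := h 2 (by norm_num)
  refine ⟨εs, hεs, fun ε₀ hε₀ hle => classical_of_dyadic_not_survivingFwd hε₀.le fun W hW => ?_⟩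
  exact H ε₀ hε₀ hle dyadicTable (inTableClass_dyadicTable le_rfl) W hW (uniformBound_dyadic hε₀ hW)

/-! ## §2 (appended): the POSITIVE TYPE-I classical form — what an analyst may assume for free -/

section Positive

open Summit.NavierStokesRegularity.NavierStokesRegularity.Theorems.WakeRatchetDyadic (dyadic_apply_ne_zero dyadic_nonneg)

/-- **THE EQUIVALENCE IN THE POSITIVE TYPE-I CLASS (fixed `ε₀ > 0`).**  «No admissible inviscid eternal solution
of the dyadic member is forward (S₁)-surviving» ⟺ «every NON-NEGATIVE real solution of (KP-crit)
`V̇_n = ΛV_{n-1}² − Λ⁻¹V_nV_{n+1}` on `t < 0` obeying the TYPE-I bound `V_n(t) ≤ C/(-t)`, with uniformly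
integrable shells and shells bounded near `0⁻`, has `(1+ε₀)^{-4n} V_n(0⁻)² → 0`».  (Positivity and type I
are automatic for admissible solutions — `dyadic_nonneg`, `uniformBound_dyadic` — so restricting the
classical statement to that class loses nothing; this is the form to hand to the dyadic-model literature:
positive ancient type-I solutions of the Katz–Pavlović chain at base `Λ = (1+ε₀)^{5/2}`.)
[cite: Tao2016AveragedNS, §1.2, §4 Thm. 4.2 (statement shape), §6.4; this file and `…WakeDyadicClassical`] -/
theorem dyadic_noSurviving_iff_classicalPos (hε : 0 < ε₀) :
    (∀ W : ℤ → ℝ → Em 4, IsEternal ε₀ dyadicTable W → ¬ EternalSurvivingFwd 1 ε₀ W) ↔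
    (∀ V : ℤ → ℝ → ℝ,
      (∀ (n : ℤ) (t : ℝ), t < 0 →
        HasDerivAt (V n) (bigLam ε₀ * V (n - 1) t ^ 2 - (bigLam ε₀)⁻¹ * (V n t * V (n + 1) t)) t) →
      (∀ (n : ℤ) (t : ℝ), t < 0 → 0 ≤ V n t) →
      (∃ C : ℝ, ∀ (n : ℤ) (t : ℝ), t < 0 → V n t ≤ C / (-t)) →
      (∃ M : ℝ, ∀ n : ℤ, IntegrableOn (fun t => |V n t|) (Iio 0) ∧ ∫ t in Iio 0, |V n t| ≤ M) →
      (∀ n : ℤ, ∃ t₀ : ℝ, t₀ < 0 ∧ ∃ P : ℝ, ∀ t : ℝ, t₀ ≤ t → t < 0 → |V n t| ≤ P) →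
      ∀ v : ℤ → ℝ, (∀ n : ℤ, Tendsto (V n) (𝓝[<] 0) (𝓝 (v n))) →
        Tendsto (fun n : ℕ => physWeight 1 ε₀ ^ n * v n ^ 2) atTop (𝓝 0)) := by
  constructor
  · intro hA V hV _ _ hact hbd v hv
    exact classical_of_dyadic_not_survivingFwd hε.le hA V hV hact hbd v hv
  · intro hB W hW
    have hW' : IsEternalVisc ε₀ 0 dyadicTable W := hW.isEternalVisc
    have hU : UniformBound W := uniformBound_dyadic hε hW
    obtain ⟨r, hr⟩ := exists_terminalProfile_fun hW'
    obtain ⟨hpos, C, hC⟩ := dyadic_classical_hyp_nonneg hε hW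
    have hlim := hB (fun n t => (-t)⁻¹ * W n (-Real.log (-t)) 0)
      (fun n t ht => dyadic_crit_hasDerivAt hW n ht) hpos
      ⟨C, fun n t ht => (le_abs_self _).trans (hC n t ht)⟩
      (dyadic_crit_action hε hW) (fun n => dyadic_crit_bdd hε hW n) (fun n => r n 0)
      (fun n => dyadic_crit_tendsto hr n)
    have hlim' : Tendsto (fun n : ℕ => physWeight 1 ε₀ ^ n * ‖r n‖ ^ 2) atTop (𝓝 0) := by
      have heq : (fun n : ℕ => physWeight 1 ε₀ ^ n * ‖r n‖ ^ 2)
          = fun n : ℕ => physWeight 1 ε₀ ^ n * (r n 0) ^ 2 := by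
        funext n
        rw [dyadic_terminal_norm_sq hε hW hr]
      rw [heq]
      exact hlim
    intro hS
    exact not_wakeFloor_of_tendsto_zero hlim' ((dyadic_survivingFwd_iff_wakeFloor hε hW hU hr).1 hS)

/-- **(ρ0) BY NAME ⇒ the positive type-I classical form below its threshold.**
[cite: Tao2016AveragedNS, §1.2, §4 Thm. 4.2 (statement shape), §6.4; this file] -/
theorem classicalPos_of_noSurvivingEternalBddOne (h : NoSurvivingEternalBddOne) :
    ∃ εs : ℝ, 0 < εs ∧ ∀ ε₀ : ℝ, 0 < ε₀ → ε₀ ≤ εs → ∀ V : ℤ → ℝ → ℝ,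
      (∀ (n : ℤ) (t : ℝ), t < 0 →
        HasDerivAt (V n) (bigLam ε₀ * V (n - 1) t ^ 2 - (bigLam ε₀)⁻¹ * (V n t * V (n + 1) t)) t) →
      (∀ (n : ℤ) (t : ℝ), t < 0 → 0 ≤ V n t) →
      (∃ C : ℝ, ∀ (n : ℤ) (t : ℝ), t < 0 → V n t ≤ C / (-t)) →
      (∃ M : ℝ, ∀ n : ℤ, IntegrableOn (fun t => |V n t|) (Iio 0) ∧ ∫ t in Iio 0, |V n t| ≤ M) →
      (∀ n : ℤ, ∃ t₀ : ℝ, t₀ < 0 ∧ ∃ P : ℝ, ∀ t : ℝ, t₀ ≤ t → t < 0 → |V n t| ≤ P) →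
      ∀ v : ℤ → ℝ, (∀ n : ℤ, Tendsto (V n) (𝓝[<] 0) (𝓝 (v n))) →
        Tendsto (fun n : ℕ => physWeight 1 ε₀ ^ n * v n ^ 2) atTop (𝓝 0) := by
  obtain ⟨εs, hεs, H⟩ := h 2 (by norm_num)
  refine ⟨εs, hεs, fun ε₀ hε₀ hle => (dyadic_noSurviving_iff_classicalPos hε₀).1 fun W hW => ?_⟩
  exact H ε₀ hε₀ hle dyadicTable (inTableClass_dyadicTable le_rfl) W hW (uniformBound_dyadic hε₀ hW)

end Positive

end Summit.NavierStokesRegularity.NavierStokesRegularity.Theorems.NoSurvivingEternalViscBddOne.WakeCriterion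

end
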